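import Summits.ValiantsHypothesis.ValiantsHypothesis.Theorems.SymPencilPerFourRowStabilizer

/-!
# Route `SymPencil` — the HYPERPLANE QUAD LEMMA for `per [v; ·]`
# (tool file for the one-row defect-2 cell `(12,4,2)` of `sdc(per_4)`, `--supports`
# stmt-ValiantsHypothesis-5674; nothing here bears on `VP ≠ VNP`)

`T(a,b,c) = per [v; a; b; c]` (all `v_j ≠ 0`, characteristic `0`).  The tree's `eq_zero_of_perm_quad`
says: a linear `Y` with `T(Y y, y, z) = 0` for all `y, z` vanishes.  The HYPERPLANE version proved here:

* **`eq_zero_on_ker_of_perm_quad`** — if `T(Y y, y, z) = 0` for all `y ∈ ker λ` and all `z`, then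
  `Y` vanishes on `ker λ` (`λ` any linear form; `λ = 0` is the tree's lemma).
* **`exists_eq_smul_of_perm_quad_hyperplane`** — if `T(Y y, y, z) = λ(y) · q(y, z)` for all `y, z`
  (any function `q`), then `Y = u ⊗ λ`, i.e. `Y y = λ(y) • u` for a fixed vector `u`.

These are the «hyperplane variants of the pair lemmas» needed for the off-diagonal blocks of an exact
flow symmetry of `F_v(y) = per [v; y 0; y 1; y 2]` on a hyperplane (val-width-5674-w2 g2's (S1); see
`SymPencilPerFourHyperplaneFlowJacobian` for the criterion they feed).  Numerically the statement is rigid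
for EVERY hyperplane (exhaustive over `F₇`, `F₁₁`); the proof is coordinates: pivot `i` with `λ(e_i) ≠ 0`,
basis `f_p = e_p − c_p e_i` of `ker λ`, the kernel of `w ↦ T(w, f_p, ·)` (`kernel_of_perm_f`, with the
RESONANCE `v_i = c_p v_p` as the only degeneracy), and the polarised identities at `(f_p, f_q, e_r)`.

Elementary; no definitions, no named facts. [folklore]
-/

noncomputable section

-- single-conjunct layout: Sub = Summit, duplicated namespace component intended
set_option linter.dupNamespace false

namespace Summit.ValiantsHypothesis.ValiantsHypothesis.Theorems.SymPencilPerFourHyperplaneQuad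

open Matrix
open Summit.ValiantsHypothesis.ValiantsHypothesis.Theorems.SymPencilPerFourInnerRankRows
open Summit.ValiantsHypothesis.ValiantsHypothesis.Theorems.SymPencilPerFourRowForms
open Summit.ValiantsHypothesis.ValiantsHypothesis.Theorems.SymPencilPerFourRowStabilizer

variable {K : Type*} [Field K]

/-! ### Evaluations at `f = e_x - c e_i` -/

/-- `per [v; w; e_q; e_q] = 0`. [folklore] -/
theorem permanent_rows_w_single_single (v w : Fin 4 → K) (q : Fin 4) :
    (Matrix.of ![v, w, Pi.single q 1, Pi.single q 1]).permanent = 0 := by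
  rw [permanent_rows_cycle, per_swap_row₂₃, permanent_rows_rep]

/-- Linearity of `per [v; w; ·; z]` at `e_x - c e_i`. [folklore] -/
theorem permanent_rows_sub_smul₂ (v w z : Fin 4 → K) (x i : Fin 4) (c : K) :
    (Matrix.of ![v, w, Pi.single x 1 - c • Pi.single i 1, z]).permanent =
      (Matrix.of ![v, w, Pi.single x 1, z]).permanent - c * (Matrix.of ![v, w, Pi.single i 1, z]).permanent := by
  simp only [permanent_of_rows, Pi.sub_apply, Pi.smul_apply, smul_eq_mul]; ring

/-- `T(w, e_x - c e_i, e_i) = v_a w_b + v_b w_a` (`{i,x,a,b} = {0,1,2,3}`). [folklore] -/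
theorem perm_f_at_i (v w : Fin 4 → K) (i x a b : Fin 4)
    (h : i ≠ x ∧ i ≠ a ∧ i ≠ b ∧ x ≠ a ∧ x ≠ b ∧ a ≠ b) (c : K) :
    (Matrix.of ![v, w, Pi.single x 1 - c • Pi.single i 1, Pi.single i 1]).permanent = v a * w b + v b * w a := by
  obtain ⟨hix, hia, hib, hxa, hxb, hab⟩ := h
  rw [permanent_rows_sub_smul₂, permanent_rows_w_single_single,
    permanent_rows_single_single v w a x i b ⟨hxa.symm, hia.symm, hab, hix.symm, hxb, hib⟩]
  ring

/-- `T(w, e_x - c e_i, e_x) = -c (v_a w_b + v_b w_a)`. [folklore] -/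
theorem perm_f_at_x (v w : Fin 4 → K) (i x a b : Fin 4)
    (h : i ≠ x ∧ i ≠ a ∧ i ≠ b ∧ x ≠ a ∧ x ≠ b ∧ a ≠ b) (c : K) :
    (Matrix.of ![v, w, Pi.single x 1 - c • Pi.single i 1, Pi.single x 1]).permanent = -c * (v a * w b + v b * w a) := by
  obtain ⟨hix, hia, hib, hxa, hxb, hab⟩ := h
  rw [permanent_rows_sub_smul₂, permanent_rows_w_single_single,
    permanent_rows_single_single v w a i x b ⟨hia.symm, hxa.symm, hab, hix, hib, hxb⟩]
  ring

/-- `T(w, e_x - c e_i, e_a) = (v_i w_b + v_b w_i) - c (v_x w_b + v_b w_x)`. [folklore] -/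
theorem perm_f_at_a (v w : Fin 4 → K) (i x a b : Fin 4)
    (h : i ≠ x ∧ i ≠ a ∧ i ≠ b ∧ x ≠ a ∧ x ≠ b ∧ a ≠ b) (c : K) :
    (Matrix.of ![v, w, Pi.single x 1 - c • Pi.single i 1, Pi.single a 1]).permanent =
      (v i * w b + v b * w i) - c * (v x * w b + v b * w x) := by
  obtain ⟨hix, hia, hib, hxa, hxb, hab⟩ := h
  rw [permanent_rows_sub_smul₂,
    permanent_rows_single_single v w i x a b ⟨hix, hia, hib, hxa, hxb, hab⟩,
    permanent_rows_single_single v w x i a b ⟨hix.symm, hxa, hxb, hia, hib, hab⟩]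

/-! ### The kernel of `w ↦ T(w, e_x - c e_i, ·)` -/

/-- **Kernel lemma.**  If `T(w, e_x − c e_i, z) = 0` for all `z` (all `v_j ≠ 0`, characteristic `0`),
then `w_i = c w_x`, `v_a w_b + v_b w_a = 0`, and — off the RESONANCE `v_i = c v_x` — `w_a = w_b = 0`.
[folklore] -/
theorem kernel_of_perm_f [CharZero K] {v : Fin 4 → K} (hv : ∀ j, v j ≠ 0) (i x a b : Fin 4)
    (h : i ≠ x ∧ i ≠ a ∧ i ≠ b ∧ x ≠ a ∧ x ≠ b ∧ a ≠ b) (c : K) (w : Fin 4 → K)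
    (hw : ∀ z : Fin 4 → K, (Matrix.of ![v, w, Pi.single x 1 - c • Pi.single i 1, z]).permanent = 0) :
    w i = c * w x ∧ v a * w b + v b * w a = 0 ∧ (v i - c * v x ≠ 0 → w a = 0 ∧ w b = 0) := by
  obtain ⟨hix, hia, hib, hxa, hxb, hab⟩ := h
  have Ei := hw (Pi.single i 1)
  have Ea := hw (Pi.single a 1)
  have Eb := hw (Pi.single b 1)
  rw [perm_f_at_i v w i x a b ⟨hix, hia, hib, hxa, hxb, hab⟩] at Ei
  rw [perm_f_at_a v w i x a b ⟨hix, hia, hib, hxa, hxb, hab⟩] at Ea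
  rw [perm_f_at_a v w i x b a ⟨hix, hib, hia, hxb, hxa, hab.symm⟩] at Eb
  have h1 : 2 * v a * v b * (w i - c * w x) = 0 := by
    linear_combination v a * Ea + v b * Eb - (v i - c * v x) * Ei
  have hi : w i = c * w x := by
    have h2 := (mul_eq_zero.1 h1).resolve_left (mul_ne_zero (mul_ne_zero two_ne_zero (hv a)) (hv b))
    linear_combination h2
  refine ⟨hi, by linear_combination Ei, fun hρ => ?_⟩
  have h3 : (v i - c * v x) * (v a * w b - v b * w a) = 0 := by
    linear_combination v a * Ea - v b * Eb
  have h4 := (mul_eq_zero.1 h3).resolve_left hρ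
  have hb' : 2 * v a * w b = 0 := by linear_combination h4 + Ei
  have hwb : w b = 0 := (mul_eq_zero.1 hb').resolve_left (mul_ne_zero two_ne_zero (hv a))
  refine ⟨?_, hwb⟩
  have ha' : v b * w a = 0 := by linear_combination Ei - v a * hwb
  exact (mul_eq_zero.1 ha').resolve_left (hv b)

/-! ### The scalar endgame -/

/-- Four pairwise distinct indices exhaust `Fin 4`. [folklore] -/
theorem exists_three_compl_cover : ∀ i : Fin 4, ∃ k l m : Fin 4,
    (i ≠ k ∧ i ≠ l ∧ i ≠ m ∧ k ≠ l ∧ k ≠ m ∧ l ≠ m) ∧ ∀ j : Fin 4, j = i ∨ j = k ∨ j = l ∨ j = m := by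
  decide

/-- **Scalar endgame, one `W`.**  In the notation of the module docstring (`W_p^r = v_p s_{p,r} + v_r s_{p,p}`),
the available implications force `W_p^r = 0`. [folklore] -/
theorem W_eq_zero [CharZero K] {vp vq vr cp cq cr spp spq spr sqq sqp sqr srr srp srq : K}
    (hvp : vp ≠ 0) (hvq : vq ≠ 0) (hvr : vr ≠ 0)
    (Hq : cq ≠ 0 → vp * spr + vr * spp = 0)
    (Hr : cr ≠ 0 → vp * spq + vq * spp = 0)
    (Hp : cp ≠ 0 → vq * sqr + vr * sqq = 0)
    (Zp : cp = 0 → spq = 0 ∧ spr = 0) (Zq : cq = 0 → sqp = 0 ∧ sqr = 0) (Zr : cr = 0 → srp = 0 ∧ srq = 0)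
    (Epq : (vp * spr + vr * spp) + (vq * sqr + vr * sqq) = 0)
    (Epr : (vp * spq + vq * spp) + (vr * srq + vq * srr) = 0)
    (Eqr : (vq * sqp + vp * sqq) + (vr * srp + vp * srr) = 0) :
    vp * spr + vr * spp = 0 := by
  by_cases hcq : cq = 0
  · by_cases hcp : cp = 0
    · obtain ⟨hpq0, hpr0⟩ := Zp hcp
      obtain ⟨hqp0, hqr0⟩ := Zq hcq
      by_cases hcr : cr = 0
      · obtain ⟨hrp0, hrq0⟩ := Zr hcr
        have h2 : 2 * vp * vq * vr * spp = 0 := by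
          linear_combination vq * vp * Epq + vr * vp * Epr - vr * vq * Eqr - vq * vp * vp * hpr0 - vq * vp * vq * hqr0
            - vr * vp * vp * hpq0 - vr * vp * vr * hrq0 + vr * vq * vq * hqp0 + vr * vq * vr * hrp0
        have hspp : spp = 0 :=
          (mul_eq_zero.1 h2).resolve_left (mul_ne_zero (mul_ne_zero (mul_ne_zero two_ne_zero hvp) hvq) hvr)
        rw [hpr0, hspp, mul_zero, mul_zero, add_zero]
      · have h1 := Hr hcr
        rw [hpq0, mul_zero, zero_add] at h1
        have hspp : spp = 0 := (mul_eq_zero.1 h1).resolve_left hvq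
        rw [hpr0, hspp, mul_zero, mul_zero, add_zero]
    · have h1 := Hp hcp
      linear_combination Epq - h1
  · exact Hq hcq

/-- **Scalar endgame, one index.**  `W_p^r = W_p^q = 0` together with the kernel relation
`v_q s_{p,r} + v_r s_{p,q} = 0` kill `s_{p,p}, s_{p,q}, s_{p,r}`. [folklore] -/
theorem s_eq_zero [CharZero K] {vp vq vr cp cq cr spp spq spr sqq sqp sqr srr srp srq : K}
    (hvp : vp ≠ 0) (hvq : vq ≠ 0) (hvr : vr ≠ 0)
    (A1 : vq * spr + vr * spq = 0)
    (Hq : cq ≠ 0 → vp * spr + vr * spp = 0) (Hr : cr ≠ 0 → vp * spq + vq * spp = 0)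
    (Hp : cp ≠ 0 → vq * sqr + vr * sqq = 0) (Hp' : cp ≠ 0 → vr * srq + vq * srr = 0)
    (Zp : cp = 0 → spq = 0 ∧ spr = 0) (Zq : cq = 0 → sqp = 0 ∧ sqr = 0) (Zr : cr = 0 → srp = 0 ∧ srq = 0)
    (Epq : (vp * spr + vr * spp) + (vq * sqr + vr * sqq) = 0)
    (Epr : (vp * spq + vq * spp) + (vr * srq + vq * srr) = 0)
    (Eqr : (vq * sqp + vp * sqq) + (vr * srp + vp * srr) = 0) :
    spp = 0 ∧ spq = 0 ∧ spr = 0 := by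
  have hWpr : vp * spr + vr * spp = 0 := W_eq_zero hvp hvq hvr Hq Hr Hp Zp Zq Zr Epq Epr Eqr
  have hWpq : vp * spq + vq * spp = 0 := by
    refine W_eq_zero (cq := cr) (cr := cq) hvp hvr hvq Hr Hq Hp' (fun h => (Zp h).symm) Zr Zq Epr Epq ?_
    linear_combination Eqr
  have h2 : 2 * vq * vr * spp = 0 := by linear_combination vq * hWpr + vr * hWpq - vp * A1
  have hspp : spp = 0 := (mul_eq_zero.1 h2).resolve_left (mul_ne_zero (mul_ne_zero two_ne_zero hvq) hvr)
  refine ⟨hspp, ?_, ?_⟩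
  · have h3 : vp * spq = 0 := by linear_combination hWpq - vq * hspp
    exact (mul_eq_zero.1 h3).resolve_left hvp
  · have h3 : vp * spr = 0 := by linear_combination hWpr - vr * hspp
    exact (mul_eq_zero.1 h3).resolve_left hvp

/-! ### The hyperplane quad lemma -/

/-- **Core (pivot form).**  `i, k, l, m` pairwise distinct covering `Fin 4`, `λ(e_i) ≠ 0`, and
`T(Y n, n, z) = 0` for all `n ∈ ker λ`, `z`; then `Y` vanishes on `ker λ`. [folklore] -/
theorem eq_zero_on_ker_of_perm_quad_aux [CharZero K] {v : Fin 4 → K} (hv : ∀ j, v j ≠ 0)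
    (i k l m : Fin 4) (hd : i ≠ k ∧ i ≠ l ∧ i ≠ m ∧ k ≠ l ∧ k ≠ m ∧ l ≠ m)
    (hcov : ∀ j : Fin 4, j = i ∨ j = k ∨ j = l ∨ j = m)
    (Y : (Fin 4 → K) →ₗ[K] (Fin 4 → K)) (lam : (Fin 4 → K) →ₗ[K] K) (hli : lam (Pi.single i 1) ≠ 0)
    (h : ∀ y z : Fin 4 → K, lam y = 0 → (Matrix.of ![v, Y y, y, z]).permanent = 0) :
    ∀ y, lam y = 0 → Y y = 0 := by
  classical
  obtain ⟨hik, hil, him, hkl, hkm, hlm⟩ := hd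
  -- the basis `f_p = e_p - c_p e_i` of `ker λ`
  set c : Fin 4 → K := fun p => lam (Pi.single p 1) / lam (Pi.single i 1) with hc
  set f : Fin 4 → (Fin 4 → K) := fun p => Pi.single p 1 - c p • Pi.single i 1 with hf
  have hfker : ∀ p, lam (f p) = 0 := by
    intro p
    simp only [hf, hc, map_sub, map_smul, smul_eq_mul]
    field_simp
    ring
  -- polarisation of the hypothesis
  have hpol : ∀ n n' z : Fin 4 → K, lam n = 0 → lam n' = 0 →
      (Matrix.of ![v, Y n, n', z]).permanent + (Matrix.of ![v, Y n', n, z]).permanent = 0 := by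
    intro n n' z hn hn'
    have h1 := h (n + n') z (by rw [map_add, hn, hn', add_zero])
    have h2 := h n z hn
    have h3 := h n' z hn'
    rw [map_add, per_add_row₁, per_add_row₂, per_add_row₂] at h1
    linear_combination h1 - h2 - h3
  -- the kernel relations for `s_p = Y (f p)`
  have hA : ∀ p a b : Fin 4, i ≠ p ∧ i ≠ a ∧ i ≠ b ∧ p ≠ a ∧ p ≠ b ∧ a ≠ b →
      Y (f p) i = c p * Y (f p) p ∧ v a * Y (f p) b + v b * Y (f p) a = 0 ∧
        (v i - c p * v p ≠ 0 → Y (f p) a = 0 ∧ Y (f p) b = 0) := by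
    intro p a b hd'
    exact kernel_of_perm_f hv i p a b hd' (c p) (Y (f p)) fun z => h (f p) z (hfker p)
  -- the pair identities at `z = e_i` and `z = e_p`
  have hEi : ∀ p q r : Fin 4, i ≠ p ∧ i ≠ q ∧ i ≠ r ∧ p ≠ q ∧ p ≠ r ∧ q ≠ r →
      (v p * Y (f p) r + v r * Y (f p) p) + (v q * Y (f q) r + v r * Y (f q) q) = 0 := by
    intro p q r ⟨hip, hiq, hir, hpq, hpr, hqr⟩
    have h1 := hpol (f p) (f q) (Pi.single i 1) (hfker p) (hfker q)
    rw [show f q = Pi.single q 1 - c q • Pi.single i 1 from rfl,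
      perm_f_at_i v (Y (f p)) i q p r ⟨hiq, hip, hir, hpq.symm, hqr, hpr⟩ (c q),
      show f p = Pi.single p 1 - c p • Pi.single i 1 from rfl,
      perm_f_at_i v (Y (f q)) i p q r ⟨hip, hiq, hir, hpq, hpr, hqr⟩ (c p)] at h1
    exact h1
  have hEp : ∀ p q r : Fin 4, i ≠ p ∧ i ≠ q ∧ i ≠ r ∧ p ≠ q ∧ p ≠ r ∧ q ≠ r →
      (v i * Y (f p) r + v r * Y (f p) i - c q * (v q * Y (f p) r + v r * Y (f p) q))
        + (-c p * (v q * Y (f q) r + v r * Y (f q) q)) = 0 := by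
    intro p q r ⟨hip, hiq, hir, hpq, hpr, hqr⟩
    have h1 := hpol (f p) (f q) (Pi.single p 1) (hfker p) (hfker q)
    rw [show f q = Pi.single q 1 - c q • Pi.single i 1 from rfl,
      perm_f_at_a v (Y (f p)) i q p r ⟨hiq, hip, hir, hpq.symm, hqr, hpr⟩ (c q),
      show f p = Pi.single p 1 - c p • Pi.single i 1 from rfl,
      perm_f_at_x v (Y (f q)) i p q r ⟨hip, hiq, hir, hpq, hpr, hqr⟩ (c p)] at h1
    exact h1
  -- CLAIM_pq: `c_p ≠ 0 ⇒ W_q^r = 0`, and `c_p = 0 ⇒ s_p` has no `q, r` components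
  have hclaim : ∀ p q r : Fin 4, i ≠ p ∧ i ≠ q ∧ i ≠ r ∧ p ≠ q ∧ p ≠ r ∧ q ≠ r →
      c p ≠ 0 → v q * Y (f q) r + v r * Y (f q) q = 0 := by
    intro p q r hd' hcp
    obtain ⟨hip, hiq, hir, hpq, hpr, hqr⟩ := hd'
    obtain ⟨A2, A1, NR⟩ := hA p q r ⟨hip, hiq, hir, hpq, hpr, hqr⟩
    have Ei := hEi p q r ⟨hip, hiq, hir, hpq, hpr, hqr⟩
    have Ep := hEp p q r ⟨hip, hiq, hir, hpq, hpr, hqr⟩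
    -- `(c_p v_p - v_i) s_{p,r} + 2 c_p W_q^r = 0`
    have P : (c p * v p - v i) * Y (f p) r + 2 * c p * (v q * Y (f q) r + v r * Y (f q) q) = 0 := by
      linear_combination c p * Ei - Ep + v r * A2 - c q * A1
    by_cases hρ : v i - c p * v p = 0
    · have h2 : 2 * c p * (v q * Y (f q) r + v r * Y (f q) q) = 0 := by
        linear_combination P + Y (f p) r * hρ
      exact (mul_eq_zero.1 h2).resolve_left (mul_ne_zero two_ne_zero hcp)
    · have hr0 : Y (f p) r = 0 := (NR hρ).2
      have h2 : 2 * c p * (v q * Y (f q) r + v r * Y (f q) q) = 0 := by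
        linear_combination P - (c p * v p - v i) * hr0
      exact (mul_eq_zero.1 h2).resolve_left (mul_ne_zero two_ne_zero hcp)
  have hzero : ∀ p q r : Fin 4, i ≠ p ∧ i ≠ q ∧ i ≠ r ∧ p ≠ q ∧ p ≠ r ∧ q ≠ r →
      c p = 0 → Y (f p) q = 0 ∧ Y (f p) r = 0 := by
    intro p q r hd' hcp
    obtain ⟨-, -, NR⟩ := hA p q r hd'
    refine NR ?_
    rw [hcp, zero_mul, sub_zero]
    exact hv i
  -- the coordinates of `s_p = Y (f p)` vanish
  have hs : ∀ p q r : Fin 4, i ≠ p ∧ i ≠ q ∧ i ≠ r ∧ p ≠ q ∧ p ≠ r ∧ q ≠ r →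
      Y (f p) i = 0 ∧ Y (f p) p = 0 ∧ Y (f p) q = 0 ∧ Y (f p) r = 0 := by
    intro p q r ⟨hip, hiq, hir, hpq, hpr, hqr⟩
    obtain ⟨A2, A1, -⟩ := hA p q r ⟨hip, hiq, hir, hpq, hpr, hqr⟩
    obtain ⟨hpp, hpq0, hpr0⟩ := s_eq_zero (hv p) (hv q) (hv r) A1
      (hclaim q p r ⟨hiq, hip, hir, hpq.symm, hqr, hpr⟩) (hclaim r p q ⟨hir, hip, hiq, hpr.symm, hqr.symm, hpq⟩)
      (hclaim p q r ⟨hip, hiq, hir, hpq, hpr, hqr⟩) (hclaim p r q ⟨hip, hir, hiq, hpr, hpq, hqr.symm⟩)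
      (hzero p q r ⟨hip, hiq, hir, hpq, hpr, hqr⟩) (hzero q p r ⟨hiq, hip, hir, hpq.symm, hqr, hpr⟩)
      (hzero r p q ⟨hir, hip, hiq, hpr.symm, hqr.symm, hpq⟩)
      (hEi p q r ⟨hip, hiq, hir, hpq, hpr, hqr⟩) (hEi p r q ⟨hip, hir, hiq, hpr, hpq, hqr.symm⟩)
      (hEi q r p ⟨hiq, hir, hip, hqr, hpq.symm, hpr.symm⟩)
    have hpi : Y (f p) i = 0 := by rw [A2, hpp, mul_zero]
    exact ⟨hpi, hpp, hpq0, hpr0⟩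
  have hk0 : Y (f k) = 0 := by
    obtain ⟨h1, h2, h3, h4⟩ := hs k l m ⟨hik, hil, him, hkl, hkm, hlm⟩
    funext j
    rcases hcov j with rfl | rfl | rfl | rfl
    exacts [h1, h2, h3, h4]
  have hl0 : Y (f l) = 0 := by
    obtain ⟨h1, h2, h3, h4⟩ := hs l k m ⟨hil, hik, him, hkl.symm, hlm, hkm⟩
    funext j
    rcases hcov j with rfl | rfl | rfl | rfl
    exacts [h1, h3, h2, h4]
  have hm0 : Y (f m) = 0 := by
    obtain ⟨h1, h2, h3, h4⟩ := hs m k l ⟨him, hik, hil, hkm.symm, hlm.symm, hkl⟩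
    funext j
    rcases hcov j with rfl | rfl | rfl | rfl
    exacts [h1, h3, h4, h2]
  -- every `y ∈ ker λ` is `y_k f_k + y_l f_l + y_m f_m`
  intro y hy
  set d : Fin 4 → K := y - (y k • f k + y l • f l + y m • f m) with hd_def
  have hdk : d k = 0 := by
    simp [hd_def, hf, Pi.single_eq_of_ne hik.symm, Pi.single_eq_of_ne hkl, Pi.single_eq_of_ne hkm]
  have hdl : d l = 0 := by
    simp [hd_def, hf, Pi.single_eq_of_ne hil.symm, Pi.single_eq_of_ne hlm, Pi.single_eq_of_ne hkl.symm]
  have hdm : d m = 0 := by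
    simp [hd_def, hf, Pi.single_eq_of_ne him.symm, Pi.single_eq_of_ne hkm.symm, Pi.single_eq_of_ne hlm.symm]
  have hdsingle : d = d i • (Pi.single i 1 : Fin 4 → K) :=
    eq_smul_single_of_apply_eq_zero i d fun p hp => by
      rcases hcov p with rfl | rfl | rfl | rfl
      · exact absurd rfl hp
      · exact hdk
      · exact hdl
      · exact hdm
  have hld : lam d = 0 := by
    simp only [hd_def, map_sub, map_add, map_smul, hy, hfker, smul_zero, add_zero, sub_zero]
  rw [hdsingle, map_smul, smul_eq_mul] at hld
  have hdi : d i = 0 := (mul_eq_zero.1 hld).resolve_right hli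
  have hd0 : d = 0 := by rw [hdsingle, hdi, zero_smul]
  have hyeq : y = y k • f k + y l • f l + y m • f m := by
    rw [← sub_eq_zero]; exact hd0
  rw [hyeq, map_add, map_add, map_smul, map_smul, map_smul, hk0, hl0, hm0, smul_zero, smul_zero, smul_zero,
    add_zero, add_zero]

/-- **The hyperplane quad lemma (kernel form).**  If `per [v; Y y; y; z] = 0` for all `y ∈ ker λ` and all
`z` (all `v_j ≠ 0`, characteristic `0`), then `Y` vanishes on `ker λ`.  For `λ = 0` this is
`eq_zero_of_perm_quad`. [folklore] -/
theorem eq_zero_on_ker_of_perm_quad [CharZero K] {v : Fin 4 → K} (hv : ∀ j, v j ≠ 0)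
    (Y : (Fin 4 → K) →ₗ[K] (Fin 4 → K)) (lam : (Fin 4 → K) →ₗ[K] K)
    (h : ∀ y z : Fin 4 → K, lam y = 0 → (Matrix.of ![v, Y y, y, z]).permanent = 0) :
    ∀ y, lam y = 0 → Y y = 0 := by
  classical
  by_cases hlam : lam = 0
  · have hY : Y = 0 := eq_zero_of_perm_quad hv Y fun y z => h y z (by rw [hlam, LinearMap.zero_apply])
    intro y _
    rw [hY, LinearMap.zero_apply]
  · -- a pivot `i` with `λ(e_i) ≠ 0`
    obtain ⟨i, hli⟩ : ∃ i, lam (Pi.single i 1) ≠ 0 := by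
      by_contra h0
      push Not at h0
      exact hlam ((Pi.basisFun K (Fin 4)).ext fun i => by rw [Pi.basisFun_apply, LinearMap.zero_apply, h0 i])
    obtain ⟨k, l, m, hd, hcov⟩ := exists_three_compl_cover i
    exact eq_zero_on_ker_of_perm_quad_aux hv i k l m hd hcov Y lam hli h

/-- **The hyperplane quad lemma (tensor form).**  If `per [v; Y y; y; z] = λ(y) · q(y, z)` for all `y, z`
(any function `q`; all `v_j ≠ 0`, characteristic `0`), then `Y = u ⊗ λ`: `Y y = λ(y) • u` for a fixed `u`.
[folklore] -/
theorem exists_eq_smul_of_perm_quad_hyperplane [CharZero K] {v : Fin 4 → K} (hv : ∀ j, v j ≠ 0)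
    (Y : (Fin 4 → K) →ₗ[K] (Fin 4 → K)) (lam : (Fin 4 → K) →ₗ[K] K) (q : (Fin 4 → K) → (Fin 4 → K) → K)
    (h : ∀ y z : Fin 4 → K, (Matrix.of ![v, Y y, y, z]).permanent = lam y * q y z) :
    ∃ u : Fin 4 → K, ∀ y, Y y = lam y • u := by
  classical
  have hker : ∀ y, lam y = 0 → Y y = 0 :=
    eq_zero_on_ker_of_perm_quad hv Y lam fun y z hy => by rw [h y z, hy, zero_mul]
  by_cases hlam : lam = 0
  · refine ⟨0, fun y => ?_⟩
    rw [hker y (by rw [hlam, LinearMap.zero_apply]), smul_zero]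
  · obtain ⟨u₀, hu₀⟩ : ∃ u₀, lam u₀ ≠ 0 := by
      by_contra h0
      push Not at h0
      exact hlam (LinearMap.ext h0)
    refine ⟨(lam u₀)⁻¹ • Y u₀, fun y => ?_⟩
    -- `y - (λ y / λ u₀) u₀ ∈ ker λ`
    have h1 := hker (y - (lam y / lam u₀) • u₀) (by
      rw [map_sub, map_smul, smul_eq_mul, div_mul_cancel₀ _ hu₀, sub_self])
    rw [map_sub, map_smul, sub_eq_zero] at h1
    rw [h1, smul_smul, div_eq_mul_inv]

end Summit.ValiantsHypothesis.ValiantsHypothesis.Theorems.SymPencilPerFourHyperplaneQuad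

end
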